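import Mathlib.Probability.Distributions.Gaussian.Basic
import Mathlib.Order.Filter.AtTopBot.Floor
import Mathlib.Topology.Order.Bornology
import Literature.MathematicalPhysics.QuantumLattice.RandomField
import Literature.MathematicalPhysics.QuantumLattice.LatticeScalarField
import Literature.MathematicalPhysics.QuantumLattice.GaugeGroups
import Literature.MathematicalPhysics.QuantumLattice.LatticeGaugeDLR
import Literature.MathematicalPhysics.QuantumLattice.WilsonLoops
import HarnessLib

-- provenance: harness21/H21/H21/Prelude/QLatticeAQFT/ContinuumLimitLGT.lean @ 5112b4f (interim HEAD d8f2665); M5 mechanical rewrite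
/-!
# Continuum (scaling) limits of lattice gauge theory

Trunk G13 (`QLatticeAQFT`), prelude item A11 `ContinuumLimitLGT` (notion `continuum_limit_lgt`).
Serves `constructive-qft` S01–S03 (Clay Yang–Mills, Euclidean form), S19, S25, S27.

## Content

Following Chatterjee, arXiv:1803.01950 §5 ("open problems": scaling limits of local
gauge-invariant fields and of macroscopic Wilson loops) and Cao–Park–Sheffield,
arXiv:2307.06790 §7, two observable schemes for the limit `a → 0` of lattice `G`-gauge theory
on `aℤᵈ ↪ ℝᵈ` are provided.

* **Local fields.** A `LocalGaugeObservable d G` is a bounded measurable gauge-invariant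
  cylinder function `O : LGConfig d G → ℝ` (e.g. the plaquette `Re tr ρ(U_p)`,
  `plaquetteObservable`). Its translates, centred by `m` and rescaled by `c`, are smeared into a
  tempered distribution `smearedGaugeField O Λ a c m U = ∑_{x ∈ Λ} c aᵈ (O(τₓ U) − m) • δ_{a x}`
  on `ℝᵈ` (`FieldConfig`, item A1), exactly as the scalar `finLatticeField` of item A7.
  A `ScalingScheme` records the bare coupling `β(a)`, field renormalisation `c(a)`, additive
  counterterm `m(a)` and torus half-side `L(a)` with `a · L(a) → ∞`.
* **Torus-primary limits (outline A-D3, review F4).** `torusSmearedLaw ρ sch O a` is the law of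
  the smeared field under the *concrete* finite-volume Wilson measure
  `ConstructiveQFT.wilsonMeasure (L := 2 L(a) + 1) ρ (β a)` of Wave 0 (lifted to periodic
  configurations on `ℤᵈ` by `torusLift` and smeared over the fundamental domain
  `box d (L a) = {−L(a), …, L(a)}ᵈ`); `HasLocalFieldContinuumLimit ρ sch O μ` says these laws
  converge in law (`TendstoInLaw`, generating functionals) to the probability measure `μ` as
  `a → 0⁺`. No predicate here quantifies over `infiniteVolumeLimitPoints ρ β` (which is only
  known to be nonempty through a sorried theorem): the infinite-volume variants
  `HasLocalFieldContinuumLimitAlong`, `HasContinuumAreaLawAlong` take the family of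
  infinite-volume states `ν : ℝ → Measure (LGConfig d G)` as an explicit argument, and consumers
  write `∃ ν, (∀ a, ν a ∈ infiniteVolumeLimitPoints ρ (sch.β a)) ∧ …`.
* **Macroscopic Wilson loops.** `HasContinuumAreaLaw ρ sch K σ`: the physical `R × T` rectangle,
  approximated by the `⌊R/a⌋ × ⌊T/a⌋` lattice rectangle in the `(0, 1)` plane, has
  `|⟨W⟩| ≤ K e^{−σ R T}` eventually as `a → 0⁺` (Jaffe–Witten §6; Chatterjee §5).
* **Asymptotic freedom.** `IsAsymptoticallyFreeScaling β N`: `β(a) − (11 N / 48 π²) log (1/a)`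
  converges as `a → 0⁺` (one-loop scaling in the convention `β = 2N/g²`; inventory
  `continuum_limit_lgt`: "β(a) ~ (11N/48π²) log(1/a)").

## Mathlib / H21 anchors

`ProbabilityTheory.IsGaussian` (Mathlib, used through A1's `IsNonGaussian`), `Nat.floor`,
`nhdsWithin 0 (Set.Ioi 0)` (`𝓝[>] 0`), `Measure.map`; H21: `FieldConfig`, `deltaConfig`,
`TendstoInLaw`, `measurable_finset_sum_smul_deltaConfig` (A1), `siteToE`, `finLatticeField`
(A7), `LGConfig`, `IsCylinder`, `IsZdGaugeInvariant`, `configShift`, `torusLift`, `plaquetteObs`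
(A9), `rectExpectation` (A10), `ConstructiveQFT.wilsonMeasure/wilsonExpectation/wilsonLoop`
(Wave 0), `StatMech.box` (G02). Mathlib has no lattice gauge theory or scaling-limit vocabulary
(grep: `Wilson`, `gauge`, `scaling limit` absent outside unrelated files).

## Design choices

* Translates use `configShift (-x) U`, i.e. `(τₓ U)(y, i) = U(y + x, i)`, so that
  `plaquetteObs ρ 0 i j (configShift (-x) U) = plaquetteObs ρ x i j U` (the observable *at* `x`).
* `ScalingScheme.side sch a = 2 * sch.L a + 1` is odd, so `[NeZero _]` (required by Wave 0) is
  automatic and `box d (L a)` is a fundamental domain of the torus centred at the origin.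
* The infinite-volume variants do not take `ρ`/`sch.β` (they would be unused): the coupling
  enters only through the consumer's side condition `ν a ∈ infiniteVolumeLimitPoints ρ (sch.β a)`.
* `HasContinuumAreaLaw` uses the coordinate directions `0 1 : Fin d` under `[NeZero d]`; it is
  meaningful for `2 ≤ d` (for `d = 1` the loop degenerates, `0 = 1`).
-/

open scoped SchwartzMap
open MeasureTheory Filter Topology Finset
open Literature.Probability.LatticeModels

namespace Literature.MathematicalPhysics.QuantumLattice

variable {d N : ℕ} {G : Type*} [Group G] [MeasurableSpace G]

/-! ### Local gauge-invariant observables -/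

variable (d G) in
/-- A *local gauge-invariant observable* of lattice `G`-gauge theory on `ℤᵈ`: a real function
`F` of the configuration which is a cylinder function with finite edge support `supp`, invariant
under all lattice gauge transformations, bounded and measurable. These are the "local fields"
whose rescaled translates one smears against test functions in a scaling limit
(Chatterjee arXiv:1803.01950 §5, Problem 5.1–5.3; Cao–Park–Sheffield arXiv:2307.06790 §7). [cite: arXiv180301950] -/
structure LocalGaugeObservable where
  /-- The observable `F : (ℤᵈ-edges → G) → ℝ`. -/
  F : LGConfig d G → ℝ
  /-- A finite set of edges on which `F` depends. -/
  supp : Finset (ZdEdge d)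
  /-- `F U` depends only on `U|_supp`. -/
  isCylinder : IsCylinder F supp
  /-- `F` is invariant under lattice gauge transformations. -/
  gaugeInvariant : IsZdGaugeInvariant F
  /-- `F` is bounded. -/
  bounded : ∃ C, ∀ U, |F U| ≤ C
  /-- `F` is measurable (product σ-algebra). -/
  measurable : Measurable F

/-! ### The plaquette observable as a local gauge-invariant observable -/

section Plaquette

variable (ρ : G →* Matrix (Fin N) (Fin N) ℂ)

/-- The four edges `(0, i), (eᵢ, j), (eⱼ, i), (0, j)` of the plaquette at the origin in the
`(i, j)` plane (Chatterjee arXiv:1803.01950 §2). Unlike `plaquetteEdges` no ordering `i < j`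
is required. [cite: arXiv180301950] -/
def originPlaquetteSupport (i j : Fin d) : Finset (ZdEdge d) :=
  {((0 : Site d), i), (Pi.single i 1, j), (Pi.single j 1, i), ((0 : Site d), j)}

omit [MeasurableSpace G] in
/-- The plaquette observable at the origin is a cylinder function of its four edges
(Chatterjee arXiv:1803.01950 §2). [cite: arXiv180301950] -/
theorem isCylinder_plaquetteObs_zero (i j : Fin d) :
    IsCylinder (plaquetteObs (G := G) ρ (0 : Site d) i j) (originPlaquetteSupport i j) := by
  intro U V h
  simp only [plaquetteObs, plaquetteHolonomyZd]
  have h1 := h ((0 : Site d), i) (by simp [originPlaquetteSupport])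
  have h2 := h (0 + Pi.single i 1, j) (by simp [originPlaquetteSupport])
  have h3 := h (0 + Pi.single j 1, i) (by simp [originPlaquetteSupport])
  have h4 := h ((0 : Site d), j) (by simp [originPlaquetteSupport])
  rw [h1, h2, h3, h4]

variable [TopologicalSpace G] [IsTopologicalGroup G]

omit [MeasurableSpace G] in
/-- For a continuous representation `ρ` the plaquette observable `U ↦ Re tr ρ(U_p)` is
continuous on `LGConfig d G` (product topology) (Seiler LNP 159 Ch. 1). [folklore] -/
theorem continuous_plaquetteObs (hρ : Continuous ρ) (x : Site d) (i j : Fin d) :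
    Continuous (plaquetteObs (G := G) ρ x i j) := by
  unfold plaquetteObs plaquetteHolonomyZd
  refine Complex.continuous_re.comp ?_
  refine Continuous.matrix_trace (hρ.comp ?_)
  fun_prop

omit [MeasurableSpace G] in
/-- On a compact gauge group the plaquette observable of a continuous representation is bounded
(a continuous function on the compact space `G^{edges}`) (Seiler LNP 159 Ch. 1). [folklore] -/
theorem exists_abs_plaquetteObs_le [CompactSpace G] (hρ : Continuous ρ) (x : Site d)
    (i j : Fin d) : ∃ C, ∀ U : LGConfig d G, |plaquetteObs ρ x i j U| ≤ C := by
  obtain ⟨C, hC⟩ := (isCompact_univ.image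
    (continuous_abs.comp (continuous_plaquetteObs ρ hρ x i j))).isBounded.bddAbove
  exact ⟨C, fun U => hC ⟨U, Set.mem_univ _, rfl⟩⟩

variable [BorelSpace G] [SecondCountableTopology G]

/-- The plaquette observable of a continuous representation is measurable (continuity, and the
product of countably many second-countable Borel spaces is Borel) (Seiler LNP 159 Ch. 1). [folklore] -/
theorem measurable_plaquetteObs (hρ : Continuous ρ) (x : Site d) (i j : Fin d) :
    Measurable (plaquetteObs (G := G) ρ x i j) :=
  (continuous_plaquetteObs ρ hρ x i j).measurable

/-- The plaquette field `Re tr ρ(U_p)`, `p` the plaquette at the origin in the `(i, j)` plane, as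
a `LocalGaugeObservable` (the local field of Chatterjee arXiv:1803.01950 Problem 5.1, whose
rescaled smeared translates should converge to "`tr F_{ij}²`"). Continuity of `ρ` supplies
measurability and (with compactness of `G`) boundedness. [cite: arXiv180301950] -/
noncomputable def plaquetteObservable [CompactSpace G] (hρ : Continuous ρ) (i j : Fin d) :
    LocalGaugeObservable d G where
  F := plaquetteObs ρ 0 i j
  supp := originPlaquetteSupport i j
  isCylinder := isCylinder_plaquetteObs_zero ρ i j
  gaugeInvariant := isZdGaugeInvariant_plaquetteObs ρ 0 i j
  bounded := exists_abs_plaquetteObs_le ρ hρ 0 i j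
  measurable := measurable_plaquetteObs ρ hρ 0 i j

/-- The underlying function of `plaquetteObservable` is `plaquetteObs ρ 0 i j`. [folklore] -/
@[simp]
theorem plaquetteObservable_F [CompactSpace G] (hρ : Continuous ρ) (i j : Fin d) :
    (plaquetteObservable (d := d) ρ hρ i j).F = plaquetteObs ρ 0 i j := rfl

end Plaquette

/-! ### Smeared, rescaled local fields -/

section Smearing

/-- The *smeared rescaled local field* of the observable `O` at lattice spacing `a`, with field
renormalisation `c` and additive counterterm `m`, over the finite volume `Λ ⊆ ℤᵈ`, as a tempered
distribution on `ℝᵈ`: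
`smearedGaugeField O Λ a c m U = ∑_{x ∈ Λ} (c aᵈ (O(τₓ U) − m)) • δ_{a x}`, i.e.
`Φ_a(f) = c aᵈ ∑_{x ∈ Λ} f(a x) (O(τₓ U) − m)` where `(τₓ U)(y, i) = U(y + x, i)`
(`= configShift (-x) U`), so that `O ∘ τₓ` is "the observable `O` at `x`"
(Chatterjee arXiv:1803.01950 §5, Problems 5.1–5.3; Cao–Park–Sheffield arXiv:2307.06790 §7;
compare `finLatticeField`). [cite: arXiv180301950] -/
noncomputable def smearedGaugeField (O : LocalGaugeObservable d G) (Λ : Finset (Site d))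
    (a c m : ℝ) (U : LGConfig d G) : FieldConfig (EuclideanSpace ℝ (Fin d)) :=
  ∑ x ∈ Λ, (c * a ^ d * (O.F (configShift (-x) U) - m)) • deltaConfig (a • siteToE x)

/-- `Φ_a(f) = ∑_{x ∈ Λ} c aᵈ (O(τₓ U) − m) f(a x)` (Chatterjee arXiv:1803.01950 §5). [cite: arXiv180301950] -/
@[simp]
theorem smearedGaugeField_apply (O : LocalGaugeObservable d G) (Λ : Finset (Site d))
    (a c m : ℝ) (U : LGConfig d G) (f : 𝓢(EuclideanSpace ℝ (Fin d), ℝ)) :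
    smearedGaugeField O Λ a c m U f =
      ∑ x ∈ Λ, c * a ^ d * (O.F (configShift (-x) U) - m) * f (a • siteToE x) := by
  simp [smearedGaugeField, smul_eq_mul]

/-- The smearing map `U ↦ Φ_a` is measurable from the product σ-algebra on `LGConfig d G` to the
Borel σ-algebra of `FieldConfig ℝᵈ` (Glimm–Jaffe 1987 §6.1; Chatterjee arXiv:1803.01950 §5). [cite: GlimmJaffe1987, §6.1] -/
@[fun_prop]
theorem measurable_smearedGaugeField (O : LocalGaugeObservable d G) (Λ : Finset (Site d))
    (a c m : ℝ) : Measurable (smearedGaugeField O Λ a c m) :=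
  measurable_finset_sum_smul_deltaConfig Λ
    (fun x (U : LGConfig d G) => c * a ^ d * (O.F (configShift (-x) U) - m))
    (fun x => ((O.measurable.comp (configShift (-x)).measurable).sub_const m).const_mul _) _

end Smearing

/-! ### Scaling schemes -/

/-- A *scaling scheme* for a lattice-gauge continuum limit `a → 0⁺`: the bare inverse coupling
`β(a)`, the multiplicative field renormalisation `c(a)`, the additive counterterm `m(a)`, and the
torus half-side `L(a) ∈ ℕ` (torus of side `2 L(a) + 1` lattice units, i.e. physical side
`≈ 2 a L(a) → ∞`) (Chatterjee arXiv:1803.01950 §5: "`β(a)`, `c(a)`, `m(a)` to be chosen";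
Jaffe–Witten §6). [cite: arXiv180301950] -/
structure ScalingScheme where
  /-- Bare inverse coupling `β(a)`. -/
  β : ℝ → ℝ
  /-- Multiplicative field renormalisation `c(a)`. -/
  c : ℝ → ℝ
  /-- Additive counterterm `m(a)`. -/
  m : ℝ → ℝ
  /-- Torus half-side `L(a)` in lattice units. -/
  L : ℝ → ℕ
  /-- The physical size of the torus diverges: `a · L(a) → ∞` as `a → 0⁺`. -/
  tendsto_L : Tendsto (fun a => a * L a) (𝓝[>] 0) atTop

namespace ScalingScheme

/-- The torus side `2 L(a) + 1` (in lattice units) of the scaling scheme at spacing `a`; odd, so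
that `box d (L a) = {−L(a), …, L(a)}ᵈ` is a fundamental domain (Jaffe–Witten §6). [folklore] -/
def side (sch : ScalingScheme) (a : ℝ) : ℕ := 2 * sch.L a + 1

/-- `sch.side a = 2 L(a) + 1`. [folklore] -/
theorem side_eq (sch : ScalingScheme) (a : ℝ) : sch.side a = 2 * sch.L a + 1 := rfl

/-- The torus side of a scaling scheme is never zero (needed by Wave 0's `wilsonMeasure`). [folklore] -/
instance neZero_side (sch : ScalingScheme) (a : ℝ) : NeZero (sch.side a) := ⟨Nat.succ_ne_zero _⟩

/-- The torus side also diverges in physical units: `a · side(a) → ∞` as `a → 0⁺`. [folklore] -/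
theorem tendsto_side (sch : ScalingScheme) :
    Tendsto (fun a => a * sch.side a) (𝓝[>] 0) atTop := by
  refine tendsto_atTop_mono' _ ?_ sch.tendsto_L
  filter_upwards [self_mem_nhdsWithin] with a (ha : 0 < a)
  gcongr
  simp only [side]
  omega

end ScalingScheme

/-! ### Torus-primary continuum limits of local fields -/

section TorusLimit

variable [TopologicalSpace G] [IsTopologicalGroup G] [CompactSpace G] [BorelSpace G]
  (ρ : G →* Matrix (Fin N) (Fin N) ℂ)

/-- The law of the smeared rescaled local field `O` at spacing `a` under the *concrete*
finite-volume Wilson measure of the scaling scheme: the torus of side `2 L(a) + 1` at coupling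
`β(a)` (Wave 0's `ConstructiveQFT.wilsonMeasure`), configurations lifted periodically to `ℤᵈ`
(`torusLift`) and smeared over the fundamental domain `box d (L a) = {−L(a), …, L(a)}ᵈ`, a cube of
physical side `≈ 2 a L(a) → ∞`. A measure on `FieldConfig ℝᵈ` (torus-primary form, outline A-D3;
Chatterjee arXiv:1803.01950 §5; Jaffe–Witten §6). [cite: arXiv180301950] -/
noncomputable def torusSmearedLaw (sch : ScalingScheme) (O : LocalGaugeObservable d G) (a : ℝ) :
    Measure (FieldConfig (EuclideanSpace ℝ (Fin d))) :=
  (QuantumFieldTheory.wilsonMeasure (d := d) (L := sch.side a) ρ (sch.β a)).map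
    (smearedGaugeField O (box d (sch.L a)) a (sch.c a) (sch.m a) ∘ torusLift (sch.side a))

omit [TopologicalSpace G] [IsTopologicalGroup G] [CompactSpace G] [BorelSpace G] in
/-- The map pushed forward in `torusSmearedLaw` is measurable (Glimm–Jaffe 1987 §6.1). [cite: GlimmJaffe1987, §6.1] -/
theorem measurable_smearedGaugeField_comp_torusLift (O : LocalGaugeObservable d G)
    (Λ : Finset (Site d)) (a c m : ℝ) (L : ℕ) :
    Measurable (smearedGaugeField O Λ a c m ∘ torusLift (G := G) L) :=
  (measurable_smearedGaugeField O Λ a c m).comp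
    (measurable_pi_lambda _ fun e => measurable_pi_apply (torusEdge L e))

/-- *Continuum limit of a local gauge-invariant field, torus-primary form*: along the scaling
scheme `sch` (coupling `β(a)`, renormalisations `c(a)`, `m(a)`, tori of side `2 L(a) + 1` with
`a L(a) → ∞`) the laws `torusSmearedLaw ρ sch O a` of the smeared rescaled field
`c(a) aᵈ ∑ₓ f(a x) (O(τₓ U) − m(a))` under the finite-volume Wilson measures converge in law
(generating functionals, `TendstoInLaw`) as `a → 0⁺` to the probability measure `μ` on
`𝒮'(ℝᵈ)` (Chatterjee arXiv:1803.01950 §5, Problems 5.1–5.3; Cao–Park–Sheffield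
arXiv:2307.06790 §7; Jaffe–Witten §6). [cite: arXiv180301950] -/
def HasLocalFieldContinuumLimit (sch : ScalingScheme) (O : LocalGaugeObservable d G)
    (μ : Measure (FieldConfig (EuclideanSpace ℝ (Fin d)))) : Prop :=
  IsProbabilityMeasure μ ∧ TendstoInLaw (torusSmearedLaw ρ sch O) (𝓝[>] 0) μ

end TorusLimit

/-! ### Infinite-volume variants (family of states as an argument) -/

section Along

/-- *Continuum limit of a local gauge-invariant field along a family of infinite-volume states*:
`ν a` is a state on `LGConfig d G` for each spacing `a` (intended: an infinite-volume limit
point at coupling `sch.β a`, a side condition `∀ a, ν a ∈ infiniteVolumeLimitPoints ρ (sch.β a)`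
which *consumers* add next to `∃ ν`; outline A-D3), and the laws of the smeared rescaled field
over the boxes `box d (L a)` (physical side `≈ 2 a L(a) → ∞`) converge in law to the probability
measure `μ` as `a → 0⁺` (Chatterjee arXiv:1803.01950 §5; Cao–Park–Sheffield arXiv:2307.06790
§7). The representation/coupling do not enter and are therefore not arguments. [cite: arXiv180301950] -/
def HasLocalFieldContinuumLimitAlong (sch : ScalingScheme) (O : LocalGaugeObservable d G)
    (ν : ℝ → Measure (LGConfig d G)) (μ : Measure (FieldConfig (EuclideanSpace ℝ (Fin d)))) :
    Prop :=
  IsProbabilityMeasure μ ∧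
    TendstoInLaw (fun a => (ν a).map (smearedGaugeField O (box d (sch.L a)) a (sch.c a) (sch.m a)))
      (𝓝[>] 0) μ

end Along

/-- A *non-trivial* limit law on `𝒮'(E)`: a probability measure which is not Gaussian
(A1 `IsNonGaussian`, i.e. `¬ ProbabilityTheory.IsGaussian μ`); "triviality" of a scaling limit
means the negation (Chatterjee arXiv:1803.01950 §5; Jaffe–Witten §6). [cite: arXiv180301950] -/
def IsNontrivialLimit {E : Type*} [NormedAddCommGroup E] [NormedSpace ℝ E]
    (μ : Measure (FieldConfig E)) : Prop :=
  IsProbabilityMeasure μ ∧ IsNonGaussian μ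

/-! ### Continuum area law for macroscopic Wilson loops -/

section AreaLaw

variable [TopologicalSpace G] [IsTopologicalGroup G] [CompactSpace G] [BorelSpace G]

/-- *Continuum area law, torus-primary form*: with string tension `σ > 0` and constant `K`, for
every physical rectangle `R × T` (`R, T > 0`), eventually as `a → 0⁺` the lattice
`⌊R/a⌋ × ⌊T/a⌋` rectangular Wilson loop in the `(0, 1)` plane based at the origin of the torus of
side `2 L(a) + 1` at coupling `β(a)` (Wave 0's normalised-trace `ConstructiveQFT.wilsonLoop`)
satisfies `|⟨W⟩_{Λ(a), β(a)}| ≤ K e^{−σ R T}` (Jaffe–Witten §6, "area law for planar rectangles";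
Chatterjee arXiv:1803.01950 §5; Cao–Park–Sheffield arXiv:2307.06790 §7). The rectangle fits in
the torus eventually since `a L(a) → ∞`. Requires `[NeZero d]` for the directions `0, 1`;
meaningful for `2 ≤ d`. [cite: arXiv180301950] -/
def HasContinuumAreaLaw [NeZero d] [NeZero N] (ρ : G →* Matrix (Fin N) (Fin N) ℂ)
    (sch : ScalingScheme) (K σ : ℝ) : Prop :=
  0 < σ ∧ ∀ R T : ℝ, 0 < R → 0 < T → ∀ᶠ a in 𝓝[>] (0 : ℝ),
    |QuantumFieldTheory.wilsonExpectation (d := d) (L := sch.side a) ρ (sch.β a)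
        (QuantumFieldTheory.wilsonLoop ρ (0 : QuantumFieldTheory.Site d (sch.side a)) 0 1
          ⌊R / a⌋₊ ⌊T / a⌋₊)| ≤ K * Real.exp (-σ * R * T)

omit [TopologicalSpace G] [IsTopologicalGroup G] [CompactSpace G] [BorelSpace G] in
/-- *Continuum area law along a family of infinite-volume states*: for the class function `χ`
(e.g. `normalisedCharacter N ∘ ρ`) and states `ν a` on `LGConfig d G` (intended: infinite-volume
limit points at coupling `β(a)`, added by consumers as a side condition), the `⌊R/a⌋ × ⌊T/a⌋`
rectangular loop expectation `rectExpectation (ν a) χ 0 1` is bounded by `K e^{−σ R T}`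
eventually as `a → 0⁺`, for all `R, T > 0`, with `σ > 0` (Jaffe–Witten §6; Chatterjee
arXiv:1803.01950 §5). [cite: arXiv180301950] -/
def HasContinuumAreaLawAlong [NeZero d] (χ : G → ℝ) (ν : ℝ → Measure (LGConfig d G))
    (K σ : ℝ) : Prop :=
  0 < σ ∧ ∀ R T : ℝ, 0 < R → 0 < T → ∀ᶠ a in 𝓝[>] (0 : ℝ),
    |rectExpectation (ν a) χ 0 1 ⌊R / a⌋₊ ⌊T / a⌋₊| ≤ K * Real.exp (-σ * R * T)

omit [TopologicalSpace G] [IsTopologicalGroup G] [CompactSpace G] [BorelSpace G] [Group G]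
  [MeasurableSpace G] in
/-- The lattice rectangle `⌊R/a⌋ × ⌊T/a⌋` fits into half the torus of a scaling scheme
eventually: `2 ⌊R/a⌋ ≤ side(a)` for `a → 0⁺`, since `a · L(a) → ∞` (so the torus-primary area
law is not vacuous and matches Wave 0's `HasAreaLaw` side conditions): for `a > 0` with
`R ≤ a L(a)` one has `⌊R/a⌋ ≤ L(a)` (`Nat.floor_le_of_le`) (Jaffe–Witten §6 for the context). [folklore] -/
theorem ScalingScheme.eventually_two_mul_floor_le_side (sch : ScalingScheme) (R : ℝ) :
    ∀ᶠ a in 𝓝[>] (0 : ℝ), 2 * ⌊R / a⌋₊ ≤ sch.side a := by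
  filter_upwards [sch.tendsto_L.eventually_ge_atTop R, self_mem_nhdsWithin] with a ha ha0
  have ha0 : (0 : ℝ) < a := ha0
  have hfloor : ⌊R / a⌋₊ ≤ sch.L a :=
    Nat.floor_le_of_le (by rw [div_le_iff₀ ha0, mul_comm]; exact ha)
  simp only [ScalingScheme.side]
  omega

/-- A continuum area law with constants `K, σ` along tori gives, for each fixed physical
rectangle, the bound `limsup_{a → 0⁺} |⟨W_{⌊R/a⌋ × ⌊T/a⌋}⟩| ≤ K e^{−σ R T}` (Mathlib
`Filter.limsup_le_of_le`; the family is cobounded since it is non-negative) (Jaffe–Witten §6 for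
the context). [folklore] -/
theorem HasContinuumAreaLaw.limsup_le [NeZero d] [NeZero N] {ρ : G →* Matrix (Fin N) (Fin N) ℂ}
    {sch : ScalingScheme} {K σ : ℝ} (h : HasContinuumAreaLaw (d := d) ρ sch K σ) {R T : ℝ}
    (hR : 0 < R) (hT : 0 < T) :
    limsup (fun a => |QuantumFieldTheory.wilsonExpectation (d := d) (L := sch.side a) ρ (sch.β a)
        (QuantumFieldTheory.wilsonLoop ρ (0 : QuantumFieldTheory.Site d (sch.side a)) 0 1
          ⌊R / a⌋₊ ⌊T / a⌋₊)|) (𝓝[>] 0) ≤ K * Real.exp (-σ * R * T) :=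
  Filter.limsup_le_of_le (isCoboundedUnder_le_of_le _ fun _ => abs_nonneg _) (h.2 R T hR hT)

end AreaLaw

/-! ### Asymptotic freedom -/

/-- The one-loop asymptotic-freedom coefficient `11 N / (48 π²)` of `SU(N)` lattice gauge theory
in the convention `β = 2N/g²`: perturbatively `β(a) ≈ (11 N / 48 π²) log (1/a) + const` as
`a → 0` (Gross–Wilczek, Politzer 1973; Jaffe–Witten §1; inventory `continuum_limit_lgt`:
"asymptotic-freedom scaling `β(a) ~ (11N/48π²) log(1/a)`"). [cite: Politzer1973] -/
noncomputable def afCoefficient (N : ℕ) : ℝ :=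
  11 * N / (48 * Real.pi ^ 2)

/-- `afCoefficient N = 11 N / (48 π²)`. [folklore] -/
theorem afCoefficient_eq (N : ℕ) : afCoefficient N = 11 * N / (48 * Real.pi ^ 2) := rfl

/-- The asymptotic-freedom coefficient is positive for `N ≥ 1`. [folklore] -/
theorem afCoefficient_pos {N : ℕ} (hN : 0 < N) : 0 < afCoefficient N := by
  unfold afCoefficient
  positivity

/-- *Asymptotically free scaling* of the bare coupling: `β(a) − (11 N / 48 π²) log (a⁻¹)`
converges to a finite constant as `a → 0⁺`, i.e. `β(a) = (11 N / 48 π²) log (1/a) + c + o(1)`,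
the one-loop renormalisation-group prediction for `SU(N)` Yang–Mills in `d = 4` in the
convention `β = 2N/g²` (other conventions rescale the coefficient; two-loop `log log`
corrections are deliberately omitted in this v0 predicate) (Jaffe–Witten §1, §6; Chatterjee
arXiv:1803.01950 §5; inventory `continuum_limit_lgt`). [cite: arXiv180301950] -/
def IsAsymptoticallyFreeScaling (β : ℝ → ℝ) (N : ℕ) : Prop :=
  ∃ c : ℝ, Tendsto (fun a => β a - afCoefficient N * Real.log a⁻¹) (𝓝[>] 0) (𝓝 c)

/-- An asymptotically free coupling diverges: `β(a) → +∞` as `a → 0⁺` (`N ≥ 1`)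
(`β = (β - k log a⁻¹) + k log a⁻¹`, a convergent term plus `k log a⁻¹ → +∞` with
`k = afCoefficient N > 0`) (Jaffe–Witten §1 for the context). [folklore] -/
theorem IsAsymptoticallyFreeScaling.tendsto_atTop {β : ℝ → ℝ} {N : ℕ} (hN : 0 < N)
    (h : IsAsymptoticallyFreeScaling β N) : Tendsto β (𝓝[>] 0) atTop := by
  obtain ⟨c, hc⟩ := h
  have hlog : Tendsto (fun a : ℝ => afCoefficient N * Real.log a⁻¹) (𝓝[>] 0) atTop :=
    (Real.tendsto_log_atTop.comp tendsto_inv_nhdsGT_zero).const_mul_atTop (afCoefficient_pos hN)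
  simpa only [sub_add_cancel] using hc.add_atTop hlog

/-! ### Asymptotic freedom with `N_f` fermion flavours (Creutz (13.3)–(13.5)) -/

/-- The one-loop coefficient with `N_f` flavours of fundamental Dirac fermions,
`γ₀ = (1/16π²)(11 N/3 − 2 N_f/3) = (11 N − 2 N_f)/(48 π²)` for `SU(N)` (Creutz, *Quarks, gluons
and lattices*, eq. (13.3); `N_f = 0` is `afCoefficient N`, `afCoefficientWith_zero`). The same
convention caveat as for `afCoefficient` applies. [cite: Creutz2022, Ch. 13 eq. (13.3)] -/
noncomputable def afCoefficientWith (N Nf : ℕ) : ℝ :=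
  (11 * N - 2 * Nf) / (48 * Real.pi ^ 2)

/-- `afCoefficientWith N N_f = (11 N − 2 N_f)/(48 π²)`. [folklore] -/
theorem afCoefficientWith_eq (N Nf : ℕ) :
    afCoefficientWith N Nf = (11 * N - 2 * Nf) / (48 * Real.pi ^ 2) := rfl

/-- Without fermions the coefficient is the pure-gauge one: `afCoefficientWith N 0 = afCoefficient N`
(Creutz (13.3) at `n_f = 0` vs. Montvay–Münster (3.261)). [cite: Creutz2022, Ch. 13 eq. (13.3)] -/
@[simp]
theorem afCoefficientWith_zero (N : ℕ) : afCoefficientWith N 0 = afCoefficient N := by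
  simp [afCoefficientWith, afCoefficient]

/-- **Asymptotic freedom bound on the number of flavours** (Creutz (13.4)): the one-loop
coefficient is positive iff `n_f < 11 n / 2`, i.e. `2 N_f < 11 N`. [cite: Creutz2022, Ch. 13 eq. (13.4)] -/
theorem afCoefficientWith_pos_iff (N Nf : ℕ) : 0 < afCoefficientWith N Nf ↔ 2 * Nf < 11 * N := by
  unfold afCoefficientWith
  rw [div_pos_iff_of_pos_right (by positivity), sub_pos]
  norm_cast

/-- In particular `SU(3)` with `N_f ≤ 16` flavours (so for the physical range `2 ≤ N_f ≤ 6` of the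
tree's `Literature.MathematicalPhysics.QuantumFieldTheory.QCD`) is asymptotically free at one loop. [cite: Creutz2022, Ch. 13 eq. (13.4)] -/
theorem afCoefficientWith_pos_su3 {Nf : ℕ} (h : Nf ≤ 16) : 0 < afCoefficientWith 3 Nf :=
  (afCoefficientWith_pos_iff 3 Nf).2 (by omega)

/-- The two-loop coefficient with `N_f` fundamental flavours,
`γ₁ = (1/16π²)² (34 N²/3 − 10 N N_f/3 − N_f (N² − 1)/N)` (Creutz eq. (13.5), Caswell 1974,
Jones 1974); at `N_f = 0` this is Montvay–Münster's `β₁ = (N/16π²)² · 34/3` ((3.262),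
`afCoefficientTwoLoopWith_zero`). [cite: Creutz2022, Ch. 13 eq. (13.5)] -/
noncomputable def afCoefficientTwoLoopWith (N Nf : ℕ) : ℝ :=
  (1 / (16 * Real.pi ^ 2)) ^ 2 * (34 * N ^ 2 / 3 - 10 * N * Nf / 3 - Nf * (N ^ 2 - 1) / N)

/-- `afCoefficientTwoLoopWith N 0 = (N/16π²)² · 34/3`, the pure-`SU(N)` two-loop coefficient of
Montvay–Münster (3.262). [cite: MontvayMunster1994, §3.3 eq. (3.262) (PDF p. 138)] -/
theorem afCoefficientTwoLoopWith_zero (N : ℕ) :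
    afCoefficientTwoLoopWith N 0 = (N / (16 * Real.pi ^ 2)) ^ 2 * (34 / 3) := by
  unfold afCoefficientTwoLoopWith
  ring

end Literature.MathematicalPhysics.QuantumLattice
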